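import Mathlib

/-!
# Sketch — crux idea `toric-newvector-switch` (cruxidea seat 2, g12) for
`AdditiveKolyvaginRoad.LevelKolyvaginSystemsAdditive` (stmt-BirchSwinnertonDyer-21396).

First lemma of the line (local, elementary): with `α = diag(p,1) ∈ T(ℚ_p)` one has
`α · K₀(p²) · α⁻¹ = K_T(p) := {k ∈ GL₂(ℤ_p) : k ≡ diagonal (mod p)}`.
Consequently, for a depth-zero representation `π` of `PGL₂(ℚ_p)` of conductor `p²`
(every additive prime `p ≥ 5` of an elliptic curve), the new line is
`π(α⁻¹) · (π^{K(p)})^{T(𝔽_p)}`, and since `α` lies in the torus, toric period sums and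
CM divisors of the newvector equal those of the torus-fixed vector of the `K`-type.
Stated here over `ℚ`-matrices with integrality predicates (no `p`-adic API needed).
-/

namespace Summit.BirchSwinnertonDyer.BirchSwinnertonDyer.Cruxes.LevelKolyvaginSystemsAdditive.ToricNewvectorSwitch

/-- All entries integral. -/
def IsIntegral (M : Matrix (Fin 2) (Fin 2) ℚ) : Prop := ∀ i j, ∃ z : ℤ, M i j = (z : ℚ)

/-- `K₀(p²)`-shape: integral with lower-left entry divisible by `p²`. -/
def InK0sq (p : ℕ) (M : Matrix (Fin 2) (Fin 2) ℚ) : Prop :=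
  IsIntegral M ∧ ∃ z : ℤ, M 1 0 = ((p : ℚ) ^ 2) * (z : ℚ)

/-- `K_T(p)`-shape: integral and congruent to a diagonal matrix mod `p`. -/
def InKT (p : ℕ) (M : Matrix (Fin 2) (Fin 2) ℚ) : Prop :=
  IsIntegral M ∧ (∃ z : ℤ, M 0 1 = (p : ℚ) * (z : ℚ)) ∧ ∃ z : ℤ, M 1 0 = (p : ℚ) * (z : ℚ)

/-- The torus element `α = diag(p, 1)` and its inverse. -/
def alpha (p : ℕ) : Matrix (Fin 2) (Fin 2) ℚ := !![(p : ℚ), 0; 0, 1]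
def alphaInv (p : ℕ) : Matrix (Fin 2) (Fin 2) ℚ := !![((p : ℚ)⁻¹), 0; 0, 1]

/-- FIRST LEMMA (torus conjugacy of the two level structures):
`M ∈ K₀(p²)`-shape iff `α M α⁻¹ ∈ K_T(p)`-shape.  (Units/determinant conditions are the same on
both sides since `det (α M α⁻¹) = det M`, so they are omitted.) -/
def FirstLemma : Prop :=
  ∀ (p : ℕ), p ≠ 0 → ∀ M : Matrix (Fin 2) (Fin 2) ℚ,
    InK0sq p M ↔ InKT p (alpha p * M * alphaInv p)

/-- Abstract shadow of the period identity: if `α` normalises nothing but merely TRANSLATES inside an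
abelian group `T` acting on a set `X`, an orbit sum over a finite `T₀`-orbit is unchanged by
precomposing with translation by `α ∈ T` commuting with `T₀` — the formal reason toric periods of
`π(α⁻¹)φ_T` and `φ_T` agree.  Stated for a commutative monoid action. -/
def OrbitSumInvariance : Prop :=
  ∀ (T X R : Type) [CommMonoid T] [MulAction T X] [AddCommMonoid R]
    (S : Finset T) (a : T) (x : X) (f : X → R),
    (∀ t ∈ S, ∃ t' ∈ S, t * a = a * t') →
    (S.sum fun t => f ((t * a) • x)) = (S.sum fun t => f ((a * t) • x))

end Summit.BirchSwinnertonDyer.BirchSwinnertonDyer.Cruxes.LevelKolyvaginSystemsAdditive.ToricNewvectorSwitch
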